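import Summits.QuantumFields.BalabanUV.InfraRed.StrongCouplingHaarMoments
import HarnessLib

/-!
# Strong-coupling front, J-SC16g: BALL SERIES — the radial exponential moments of `SU(2)` as power
series with two-sided polynomial brackets — observatory of the non-perturbative crossover; no mass-gap claim

IR-3 v2 TWO-FRONT CROSSOVER LEDGER, front SC (`β₀`), SU(2), `d = 4`, Wilson normalisation `β_W = 4/g²`.
ABSOLUTE RULE of this package: No internally-minted statement may enter as a cited fact. Every hypothesis is either
kernel-proved in this package or a verbatim quotation of a PUBLISHED theorem with page reference. The manuscript(s)
under audit are NOT citable for their own disputed steps — they are the thing under adjudication; programme-internal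
(2001/route/tribunal) claims are never citable. Nothing is cited in this file: every statement is elementary and
proved here ([folklore] labels are attributions, not citations).

WHAT THIS FILE PROVES (second brick of the kernel port of the ball-flux certificate for the tree's typed open node
`StrongCouplingQuarterCovariance.QuarterCovariance`; the certificate is an inequality between the quantities below):
* `hasSum_intervalIntegral_pow_mul`: TERMWISE RADIAL INTEGRATION — if `f(s) = Σ_n s^n c_n / n!` with `|c_n| ≤ 1`, then
  `∫₀¹ r^a f(κ r) dr = Σ_n κ^n c_n / (n! (n + a + 1))` (dominated convergence on `[0, 1]`);
* `hasSum_ball`: hence the BALL MOMENTS of the Haar probability measure `σ` of `SU(2)`,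
  `∫₀¹ r^a (∫ x₀^k e^{κ r x₀} dσ) dr = Σ_n κ^n/(n! (n+a+1)) ∫ x₀^(k+n) dσ` (`x₀ = Re g₀₀`, all `k a : ℕ`, all real `κ`),
  whose coefficients are the closed-form moments of `StrongCouplingHaarMoments` (`even_moments` lists `x₀⁴ … x₀¹⁰`);
* `le_partial_add_of_hasSum` / `partial_le_of_hasSum`: the two-sided POLYNOMIAL BRACKET of a power series with
  coefficients in `[0, 1/n!]` at `κ ≥ 0`: `Σ_{n<N} x_n κ^n ≤ S ≤ Σ_{n<N} x_n κ^n + κ^N e^κ / N!`, and `exp_le_four`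
  (`e^κ ≤ 4` on the Dobrushin range `κ ≤ 4/3`), packaged as `ball_bracket` / `sphere_bracket` (partial sum `≤` moment `≤`
  partial sum `+ 4 κ^N/N!`) and `ball_le_eval` / `sphere_le_eval` (upper bounds evaluated at `κ = 4/3`).
METHOD: `intervalIntegral.hasSum_integral_of_dominated_convergence` with the summable bound `|κ|^n/n!`, the tree's
`hasSum_integral_pow_mul_exp`, `(n+N)! ≥ n! N!`, and `Real.exp_bound'` at `2/3`.  No definitions, no numerics beyond
`norm_num` on rationals.

NOT CLAIMED: the certificate itself, anything about tilted measures or `QuarterCovariance`; no mass-gap claim.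
-/

noncomputable section

open MeasureTheory Filter Finset Real intervalIntegral
open scoped NNReal Quaternion Matrix BigOperators Topology Nat
open Matrix Complex
open Literature.MathematicalPhysics.QuantumLattice (su2Quat)
open Literature.MathematicalPhysics.QuantumFieldTheory
open Literature.MathematicalPhysics.QuantumFieldTheory.Balaban1983to89.StrongCouplingVarianceWindow
  (integral_re_pow_odd integral_re_sq sq_sum_su2Quat)
open Summit.QuantumFields.BalabanUV.InfraRed.StrongCouplingHaarMoments (hasSum_integral_pow_mul_exp
  integral_re_pow_add_two)

namespace Summit.QuantumFields.BalabanUV.InfraRed.StrongCouplingBallSeries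

/-- `n! · N! ≤ (n + N)!` (as reals). [folklore] -/
theorem factorial_mul_factorial_le_real (n N : ℕ) : (n ! : ℝ) * N ! ≤ (n + N) ! := by
  have h := Nat.le_of_dvd (Nat.factorial_pos _) (Nat.factorial_mul_factorial_dvd_factorial_add n N)
  exact_mod_cast h

/-- **Upper bracket**: if `S = Σ x_n κ^n` with `x_n ≤ 1/n!` and `κ ≥ 0`, then for every `N`,
`S ≤ Σ_{n<N} x_n κ^n + κ^N e^κ / N!` (tail `Σ_{n≥N} κ^n/n! ≤ κ^N/N! · Σ_j κ^j/j!`). [folklore] -/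
theorem le_partial_add_of_hasSum {x : ℕ → ℝ} {κ S : ℝ} (hκ : 0 ≤ κ) (hx : ∀ n, x n ≤ 1 / n !)
    (h : HasSum (fun n => x n * κ ^ n) S) (N : ℕ) :
    S ≤ ∑ n ∈ range N, x n * κ ^ n + κ ^ N * Real.exp κ / N ! := by
  have h1 := (hasSum_nat_add_iff' N).2 h
  have h3 : HasSum (fun n : ℕ => κ ^ N / N ! * (κ ^ n / n !)) (κ ^ N / N ! * Real.exp κ) := by
    have h := NormedSpace.expSeries_div_hasSum_exp κ
    rw [← congrFun Real.exp_eq_exp_ℝ κ] at h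
    exact h.mul_left _
  have h2 : ∀ n, x (n + N) * κ ^ (n + N) ≤ κ ^ N / N ! * (κ ^ n / n !) := by
    intro n
    have hf : (0 : ℝ) < n ! * N ! := by positivity
    have hfa : (0 : ℝ) < (n + N) ! := by positivity
    have hxle : x (n + N) ≤ 1 / (n ! * N !) := by
      refine (hx (n + N)).trans ?_
      rw [div_le_div_iff₀ hfa hf, one_mul, one_mul]
      exact factorial_mul_factorial_le_real n N
    have hk : 0 ≤ κ ^ (n + N) := pow_nonneg hκ _
    calc x (n + N) * κ ^ (n + N) ≤ 1 / (n ! * N !) * κ ^ (n + N) := mul_le_mul_of_nonneg_right hxle hk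
      _ = κ ^ N / N ! * (κ ^ n / n !) := by rw [pow_add]; field_simp
  have h4 := hasSum_le h2 h1 h3
  have h5 : κ ^ N / N ! * Real.exp κ = κ ^ N * Real.exp κ / N ! := by ring
  linarith

/-- **Lower bracket**: if in addition `0 ≤ x_n`, every partial sum is below `S`. [folklore] -/
theorem partial_le_of_hasSum {x : ℕ → ℝ} {κ S : ℝ} (hκ : 0 ≤ κ) (hx0 : ∀ n, 0 ≤ x n)
    (h : HasSum (fun n => x n * κ ^ n) S) (N : ℕ) : ∑ n ∈ range N, x n * κ ^ n ≤ S :=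
  sum_le_hasSum (range N) (fun n _ => mul_nonneg (hx0 n) (pow_nonneg hκ n)) h

/-- `e^{2/3} ≤ 39/20` (Taylor with remainder, `Real.exp_bound'`). [folklore] -/
theorem exp_two_thirds_le : Real.exp (2 / 3) ≤ 39 / 20 := by
  have h := Real.exp_bound' (x := 2 / 3) (by norm_num) (by norm_num) (n := 4) (by norm_num)
  have hs : ∑ m ∈ range 4, (2 / 3 : ℝ) ^ m / m.factorial = 157 / 81 := by
    simp only [sum_range_succ, sum_range_zero, Nat.factorial]
    norm_num
  rw [hs] at h
  norm_num [Nat.factorial] at h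
  linarith

/-- **`e^κ ≤ 4` on the Dobrushin range `κ ≤ 4/3`** (`e^{4/3} = (e^{2/3})² ≤ (39/20)² < 4`). [folklore] -/
theorem exp_le_four {κ : ℝ} (hκ : κ ≤ 4 / 3) : Real.exp κ ≤ 4 := by
  have h1 : Real.exp κ ≤ Real.exp (4 / 3) := Real.exp_le_exp.2 hκ
  have h2 : Real.exp (4 / 3) = Real.exp (2 / 3) * Real.exp (2 / 3) := by
    rw [← Real.exp_add]; norm_num
  have h3 := exp_two_thirds_le
  have h4 : 0 ≤ Real.exp (2 / 3) := (Real.exp_pos _).le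
  nlinarith

/-- **Evaluated upper bracket on `[0, 4/3]`**: with `0 ≤ x_n ≤ 1/n!` and `0 ≤ κ ≤ 4/3`,
`S ≤ Σ_{n<N} x_n (4/3)^n + 4 (4/3)^N / N!`. [folklore] -/
theorem le_eval_of_hasSum {x : ℕ → ℝ} {κ S : ℝ} (hκ : 0 ≤ κ) (hκ' : κ ≤ 4 / 3) (hx0 : ∀ n, 0 ≤ x n)
    (hx : ∀ n, x n ≤ 1 / n !) (h : HasSum (fun n => x n * κ ^ n) S) (N : ℕ) :
    S ≤ ∑ n ∈ range N, x n * (4 / 3) ^ n + 4 * (4 / 3) ^ N / N ! := by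
  have h1 := le_partial_add_of_hasSum hκ hx h N
  have h2 : ∑ n ∈ range N, x n * κ ^ n ≤ ∑ n ∈ range N, x n * (4 / 3) ^ n :=
    sum_le_sum fun n _ => mul_le_mul_of_nonneg_left (pow_le_pow_left₀ hκ hκ' n) (hx0 n)
  have h3 : κ ^ N * Real.exp κ / N ! ≤ 4 * (4 / 3) ^ N / N ! := by
    have hN : (0 : ℝ) < N ! := by positivity
    rw [div_le_div_iff₀ hN hN]
    refine mul_le_mul_of_nonneg_right ?_ hN.le
    rw [mul_comm]
    exact mul_le_mul (exp_le_four hκ') (pow_le_pow_left₀ hκ hκ' N) (pow_nonneg hκ N) (by norm_num)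
  linarith

/-- The upper bracket as a function of `κ ∈ [0, 4/3]`: `S ≤ Σ_{n<N} x_n κ^n + 4 κ^N / N!`. [folklore] -/
theorem le_partial_add_four_of_hasSum {x : ℕ → ℝ} {κ S : ℝ} (hκ : 0 ≤ κ) (hκ' : κ ≤ 4 / 3)
    (hx : ∀ n, x n ≤ 1 / n !) (h : HasSum (fun n => x n * κ ^ n) S) (N : ℕ) :
    S ≤ ∑ n ∈ range N, x n * κ ^ n + 4 * κ ^ N / N ! := by
  have h1 := le_partial_add_of_hasSum hκ hx h N
  have h3 : κ ^ N * Real.exp κ / N ! ≤ 4 * κ ^ N / N ! := by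
    have hN : (0 : ℝ) < N ! := by positivity
    rw [div_le_div_iff₀ hN hN]
    refine mul_le_mul_of_nonneg_right ?_ hN.le
    rw [mul_comm]
    exact mul_le_mul_of_nonneg_right (exp_le_four hκ') (pow_nonneg hκ N)
  linarith

/-- **Termwise radial integration** (dominated convergence on `[0,1]` with the summable bound `|κ|^n/n!`):
if `f(s) = Σ_n s^n c_n / n!` for every real `s`, with `|c_n| ≤ 1`, then for all `a : ℕ` and real `κ`,
`∫₀¹ r^a f(κ r) dr = Σ_n κ^n c_n / (n! (n + a + 1))`. [folklore] -/
theorem hasSum_intervalIntegral_pow_mul {c : ℕ → ℝ} (hc : ∀ n, |c n| ≤ 1) {f : ℝ → ℝ}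
    (hf : ∀ s, HasSum (fun n => s ^ n / n ! * c n) (f s)) (a : ℕ) (κ : ℝ) :
    HasSum (fun n => κ ^ n / (n ! * (n + a + 1)) * c n) (∫ r in (0:ℝ)..1, r ^ a * f (κ * r)) := by
  set F : ℕ → ℝ → ℝ := fun n r => r ^ a * ((κ * r) ^ n / n ! * c n) with hF
  have hmeas : ∀ n, AEStronglyMeasurable (F n) (volume.restrict (Set.uIoc (0:ℝ) 1)) := fun n =>
    ((continuous_pow a).mul ((((continuous_const.mul continuous_id).pow n).div_const _).mul
      continuous_const)).aestronglyMeasurable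
  have hbound : ∀ n, ∀ᵐ t ∂volume, t ∈ Set.uIoc (0:ℝ) 1 → ‖F n t‖ ≤ |κ| ^ n / n ! := by
    intro n
    refine ae_of_all _ fun t ht => ?_
    rw [Set.uIoc_of_le zero_le_one] at ht
    have ht0 : 0 ≤ t := ht.1.le
    have ht1 : t ≤ 1 := ht.2
    rw [hF, Real.norm_eq_abs]
    simp only
    rw [abs_mul, abs_mul, abs_div, abs_pow, abs_pow, abs_mul, Nat.abs_cast, abs_of_nonneg ht0]
    have h1 : t ^ a ≤ 1 := pow_le_one₀ ht0 ht1
    have h2 : (|κ| * t) ^ n ≤ |κ| ^ n := by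
      rw [mul_pow]
      exact mul_le_of_le_one_right (pow_nonneg (abs_nonneg κ) n) (pow_le_one₀ ht0 ht1)
    have h3 : 0 ≤ (|κ| * t) ^ n / n ! * |c n| := by positivity
    calc t ^ a * ((|κ| * t) ^ n / ↑n ! * |c n|) ≤ 1 * ((|κ| * t) ^ n / ↑n ! * |c n|) :=
          mul_le_mul_of_nonneg_right h1 h3
      _ = (|κ| * t) ^ n / ↑n ! * |c n| := one_mul _
      _ ≤ |κ| ^ n / ↑n ! * 1 := by
          refine mul_le_mul ?_ (hc n) (abs_nonneg _) (by positivity)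
          exact div_le_div_of_nonneg_right h2 (by positivity)
      _ = |κ| ^ n / n ! := mul_one _
  have hsum : ∀ᵐ t ∂volume, t ∈ Set.uIoc (0:ℝ) 1 → Summable fun n => |κ| ^ n / (n ! : ℝ) :=
    ae_of_all _ fun t _ => Real.summable_pow_div_factorial |κ|
  have hint : IntervalIntegrable (fun _ : ℝ => ∑' n, |κ| ^ n / (n ! : ℝ)) volume 0 1 := intervalIntegrable_const
  have hlim : ∀ᵐ t ∂volume, t ∈ Set.uIoc (0:ℝ) 1 → HasSum (fun n => F n t) (t ^ a * f (κ * t)) :=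
    ae_of_all _ fun t _ => (hf (κ * t)).mul_left (t ^ a)
  have h := intervalIntegral.hasSum_integral_of_dominated_convergence (μ := volume) (a := 0) (b := 1)
    (fun n _ => |κ| ^ n / (n ! : ℝ)) hmeas hbound hsum hint hlim
  have hFn : ∀ n, ∫ t in (0:ℝ)..1, F n t = κ ^ n / (n ! * (n + a + 1)) * c n := by
    intro n
    have e : F n = fun t => κ ^ n / n ! * c n * t ^ (n + a) := by
      funext t; rw [hF]; simp only; rw [mul_pow, pow_add]; ring
    rw [e, intervalIntegral.integral_const_mul, integral_pow]
    have hn : (n : ℝ) + a + 1 ≠ 0 := by positivity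
    simp only [one_pow, ne_eq, Nat.add_eq_zero_iff, one_ne_zero, and_false, not_false_eq_true, zero_pow, sub_zero]
    push_cast
    field_simp
  simpa only [hFn] using h

/-- `|∫ x₀^n dσ| ≤ 1`. [folklore] -/
theorem abs_integral_re_pow_le_one (n : ℕ) :
    |∫ g : Matrix.specialUnitaryGroup (Fin 2) ℂ, (su2Quat g).re ^ n
      ∂haarProbability (Matrix.specialUnitaryGroup (Fin 2) ℂ)| ≤ 1 := by
  have hb : ∀ g : Matrix.specialUnitaryGroup (Fin 2) ℂ, |(su2Quat g).re ^ n| ≤ 1 := fun g => by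
    rw [abs_pow]
    have h := sq_sum_su2Quat g
    have h1 : |(su2Quat g).re| ≤ 1 := by
      rw [abs_le]; constructor <;>
        nlinarith [sq_nonneg (su2Quat g).imI, sq_nonneg (su2Quat g).imJ, sq_nonneg (su2Quat g).imK]
    exact pow_le_one₀ (abs_nonneg _) h1
  refine (MeasureTheory.abs_integral_le_integral_abs).trans ?_
  have h := integral_mono_of_nonneg (μ := haarProbability (Matrix.specialUnitaryGroup (Fin 2) ℂ))
    (ae_of_all _ fun g => abs_nonneg ((su2Quat g).re ^ n)) (integrable_const (1:ℝ)) (ae_of_all _ hb)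
  simpa using h

/-- `0 ≤ ∫ x₀^n dσ` (even: nonnegative integrand; odd: the integral vanishes). [folklore] -/
theorem integral_re_pow_nonneg (n : ℕ) :
    0 ≤ ∫ g : Matrix.specialUnitaryGroup (Fin 2) ℂ, (su2Quat g).re ^ n
      ∂haarProbability (Matrix.specialUnitaryGroup (Fin 2) ℂ) := by
  rcases Nat.even_or_odd n with ⟨j, rfl⟩ | ⟨j, rfl⟩
  · exact integral_nonneg fun g => by rw [← two_mul]; exact (even_two_mul j).pow_nonneg _
  · rw [integral_re_pow_odd j]

/-- **Ball moments as power series**: for all `k a : ℕ` and real `κ`,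
`∫₀¹ r^a (∫ x₀^k e^{κ r x₀} dσ) dr = Σ_n κ^n/(n! (n + a + 1)) · ∫ x₀^(k+n) dσ`. [folklore] -/
theorem hasSum_ball (k a : ℕ) (κ : ℝ) :
    HasSum (fun n : ℕ => κ ^ n / (n ! * (n + a + 1)) *
        ∫ g : Matrix.specialUnitaryGroup (Fin 2) ℂ, (su2Quat g).re ^ (k + n)
          ∂haarProbability (Matrix.specialUnitaryGroup (Fin 2) ℂ))
      (∫ r in (0:ℝ)..1, r ^ a * ∫ g : Matrix.specialUnitaryGroup (Fin 2) ℂ,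
        (su2Quat g).re ^ k * Real.exp (κ * r * (su2Quat g).re)
          ∂haarProbability (Matrix.specialUnitaryGroup (Fin 2) ℂ)) :=
  hasSum_intervalIntegral_pow_mul (fun n => abs_integral_re_pow_le_one (k + n))
    (f := fun s => ∫ g : Matrix.specialUnitaryGroup (Fin 2) ℂ,
      (su2Quat g).re ^ k * Real.exp (s * (su2Quat g).re) ∂haarProbability (Matrix.specialUnitaryGroup (Fin 2) ℂ))
    (fun s => by simpa only [div_mul_eq_mul_div, mul_comm] using hasSum_integral_pow_mul_exp k s) a κ

/-- Monotonicity of the evaluated bracket: for `0 ≤ κ ≤ K` and `x_n ≥ 0`,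
`Σ_{n<N} x_n κ^n + 4 κ^N/N! ≤ Σ_{n<N} x_n K^n + 4 K^N/N!`. [folklore] -/
theorem partial_add_four_mono {x : ℕ → ℝ} {κ K : ℝ} (hκ : 0 ≤ κ) (hκK : κ ≤ K) (hx0 : ∀ n, 0 ≤ x n) (N : ℕ) :
    ∑ n ∈ range N, x n * κ ^ n + 4 * κ ^ N / N ! ≤ ∑ n ∈ range N, x n * K ^ n + 4 * K ^ N / N ! := by
  have h2 : ∑ n ∈ range N, x n * κ ^ n ≤ ∑ n ∈ range N, x n * K ^ n :=
    sum_le_sum fun n _ => mul_le_mul_of_nonneg_left (pow_le_pow_left₀ hκ hκK n) (hx0 n)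
  have h3 : 4 * κ ^ N / N ! ≤ 4 * K ^ N / N ! :=
    div_le_div_of_nonneg_right (mul_le_mul_of_nonneg_left (pow_le_pow_left₀ hκ hκK N) (by norm_num))
      (by positivity)
  linarith

/-- The coefficients `(∫ x₀^(k+n) dσ)/(n! w)` (`w ≥ 1`) of the ball and sphere series are in `[0, 1/n!]`. [folklore] -/
theorem coeff_mem (k n : ℕ) {w : ℝ} (hw : 1 ≤ w) :
    0 ≤ 1 / ((n ! : ℝ) * w) * ∫ g : Matrix.specialUnitaryGroup (Fin 2) ℂ, (su2Quat g).re ^ (k + n)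
        ∂haarProbability (Matrix.specialUnitaryGroup (Fin 2) ℂ) ∧
    1 / ((n ! : ℝ) * w) * ∫ g : Matrix.specialUnitaryGroup (Fin 2) ℂ, (su2Quat g).re ^ (k + n)
        ∂haarProbability (Matrix.specialUnitaryGroup (Fin 2) ℂ) ≤ 1 / n ! := by
  have hw0 : 0 < w := by linarith
  have hn : (0 : ℝ) < n ! := by positivity
  refine ⟨mul_nonneg (by positivity) (integral_re_pow_nonneg _), ?_⟩
  have h1 := (abs_le.1 (abs_integral_re_pow_le_one (k + n))).2
  calc 1 / ((n ! : ℝ) * w) * _ ≤ 1 / ((n ! : ℝ) * w) * 1 := mul_le_mul_of_nonneg_left h1 (by positivity)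
    _ ≤ 1 / n ! := by
        rw [mul_one, div_le_div_iff₀ (by positivity) hn, one_mul, one_mul]
        exact le_mul_of_one_le_right hn.le hw

/-- **Two-sided bracket of a ball moment** on the Dobrushin range `0 ≤ κ ≤ 4/3`, for every truncation order `N`:
`Σ_{n<N} κ^n/(n!(n+a+1)) ∫ x₀^(k+n) dσ ≤ ∫₀¹ r^a ∫ x₀^k e^{κ r x₀} dσ dr ≤ (same sum) + 4 κ^N/N!`. [folklore] -/
theorem ball_bracket (k a : ℕ) {κ : ℝ} (hκ : 0 ≤ κ) (hκ' : κ ≤ 4 / 3) (N : ℕ) :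
    ∑ n ∈ range N, κ ^ n / (n ! * (n + a + 1)) *
        ∫ g : Matrix.specialUnitaryGroup (Fin 2) ℂ, (su2Quat g).re ^ (k + n)
          ∂haarProbability (Matrix.specialUnitaryGroup (Fin 2) ℂ)
      ≤ ∫ r in (0:ℝ)..1, r ^ a * ∫ g : Matrix.specialUnitaryGroup (Fin 2) ℂ,
        (su2Quat g).re ^ k * Real.exp (κ * r * (su2Quat g).re) ∂haarProbability (Matrix.specialUnitaryGroup (Fin 2) ℂ) ∧
    ∫ r in (0:ℝ)..1, r ^ a * ∫ g : Matrix.specialUnitaryGroup (Fin 2) ℂ,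
        (su2Quat g).re ^ k * Real.exp (κ * r * (su2Quat g).re) ∂haarProbability (Matrix.specialUnitaryGroup (Fin 2) ℂ)
      ≤ ∑ n ∈ range N, κ ^ n / (n ! * (n + a + 1)) *
          ∫ g : Matrix.specialUnitaryGroup (Fin 2) ℂ, (su2Quat g).re ^ (k + n)
            ∂haarProbability (Matrix.specialUnitaryGroup (Fin 2) ℂ) + 4 * κ ^ N / N ! := by
  have h := hasSum_ball k a κ
  have h' : HasSum (fun n : ℕ => (1 / (n ! * (n + a + 1)) *
      ∫ g : Matrix.specialUnitaryGroup (Fin 2) ℂ, (su2Quat g).re ^ (k + n)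
        ∂haarProbability (Matrix.specialUnitaryGroup (Fin 2) ℂ)) * κ ^ n)
      (∫ r in (0:ℝ)..1, r ^ a * ∫ g : Matrix.specialUnitaryGroup (Fin 2) ℂ,
        (su2Quat g).re ^ k * Real.exp (κ * r * (su2Quat g).re) ∂haarProbability (Matrix.specialUnitaryGroup (Fin 2) ℂ)) := by
    convert h using 1; funext n; ring
  have hw : ∀ n : ℕ, (1 : ℝ) ≤ n + a + 1 := fun n => by
    linarith [(Nat.cast_nonneg n : (0:ℝ) ≤ n), (Nat.cast_nonneg a : (0:ℝ) ≤ a)]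
  have hlo := partial_le_of_hasSum hκ (fun n => (coeff_mem k n (hw n)).1) h' N
  have hhi := le_partial_add_four_of_hasSum hκ hκ' (fun n => (coeff_mem k n (hw n)).2) h' N
  have e : ∑ n ∈ range N, (1 / (n ! * (n + a + 1)) *
      ∫ g : Matrix.specialUnitaryGroup (Fin 2) ℂ, (su2Quat g).re ^ (k + n)
        ∂haarProbability (Matrix.specialUnitaryGroup (Fin 2) ℂ)) * κ ^ n =
      ∑ n ∈ range N, κ ^ n / (n ! * (n + a + 1)) *
        ∫ g : Matrix.specialUnitaryGroup (Fin 2) ℂ, (su2Quat g).re ^ (k + n)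
          ∂haarProbability (Matrix.specialUnitaryGroup (Fin 2) ℂ) := sum_congr rfl fun n _ => by ring
  rw [e] at hlo hhi
  exact ⟨hlo, hhi⟩

/-- **Evaluated upper bound of a ball moment**: for `0 ≤ κ ≤ 4/3`,
`∫₀¹ r^a ∫ x₀^k e^{κ r x₀} dσ dr ≤ Σ_{n<N} (4/3)^n/(n!(n+a+1)) ∫ x₀^(k+n) dσ + 4 (4/3)^N/N!`. [folklore] -/
theorem ball_le_eval (k a : ℕ) {κ : ℝ} (hκ : 0 ≤ κ) (hκ' : κ ≤ 4 / 3) (N : ℕ) :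
    ∫ r in (0:ℝ)..1, r ^ a * ∫ g : Matrix.specialUnitaryGroup (Fin 2) ℂ,
        (su2Quat g).re ^ k * Real.exp (κ * r * (su2Quat g).re) ∂haarProbability (Matrix.specialUnitaryGroup (Fin 2) ℂ)
      ≤ ∑ n ∈ range N, (4 / 3 : ℝ) ^ n / (n ! * (n + a + 1)) *
          ∫ g : Matrix.specialUnitaryGroup (Fin 2) ℂ, (su2Quat g).re ^ (k + n)
            ∂haarProbability (Matrix.specialUnitaryGroup (Fin 2) ℂ) + 4 * (4 / 3) ^ N / N ! := by
  have hw : ∀ n : ℕ, (1 : ℝ) ≤ n + a + 1 := fun n => by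
    linarith [(Nat.cast_nonneg n : (0:ℝ) ≤ n), (Nat.cast_nonneg a : (0:ℝ) ≤ a)]
  refine (ball_bracket k a hκ hκ' N).2.trans ?_
  have hm := partial_add_four_mono (N := N) hκ hκ' (fun n => (coeff_mem k n (hw n)).1)
  have e1 : ∀ t : ℝ, ∑ n ∈ range N, (1 / (n ! * (n + a + 1)) *
      ∫ g : Matrix.specialUnitaryGroup (Fin 2) ℂ, (su2Quat g).re ^ (k + n)
        ∂haarProbability (Matrix.specialUnitaryGroup (Fin 2) ℂ)) * t ^ n =
      ∑ n ∈ range N, t ^ n / (n ! * (n + a + 1)) *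
        ∫ g : Matrix.specialUnitaryGroup (Fin 2) ℂ, (su2Quat g).re ^ (k + n)
          ∂haarProbability (Matrix.specialUnitaryGroup (Fin 2) ℂ) := fun t => sum_congr rfl fun n _ => by ring
  rw [e1, e1] at hm
  exact hm

/-- **Two-sided bracket of an exponential (sphere) moment** on `0 ≤ κ ≤ 4/3`:
`Σ_{n<N} κ^n/n! ∫ x₀^(k+n) dσ ≤ ∫ x₀^k e^{κ x₀} dσ ≤ (same sum) + 4 κ^N/N!`. [folklore] -/
theorem sphere_bracket (k : ℕ) {κ : ℝ} (hκ : 0 ≤ κ) (hκ' : κ ≤ 4 / 3) (N : ℕ) :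
    ∑ n ∈ range N, κ ^ n / n ! *
        ∫ g : Matrix.specialUnitaryGroup (Fin 2) ℂ, (su2Quat g).re ^ (k + n)
          ∂haarProbability (Matrix.specialUnitaryGroup (Fin 2) ℂ)
      ≤ ∫ g : Matrix.specialUnitaryGroup (Fin 2) ℂ, (su2Quat g).re ^ k * Real.exp (κ * (su2Quat g).re)
        ∂haarProbability (Matrix.specialUnitaryGroup (Fin 2) ℂ) ∧
    ∫ g : Matrix.specialUnitaryGroup (Fin 2) ℂ, (su2Quat g).re ^ k * Real.exp (κ * (su2Quat g).re)
        ∂haarProbability (Matrix.specialUnitaryGroup (Fin 2) ℂ)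
      ≤ ∑ n ∈ range N, κ ^ n / n ! *
          ∫ g : Matrix.specialUnitaryGroup (Fin 2) ℂ, (su2Quat g).re ^ (k + n)
            ∂haarProbability (Matrix.specialUnitaryGroup (Fin 2) ℂ) + 4 * κ ^ N / N ! := by
  have h := hasSum_integral_pow_mul_exp k κ
  have h' : HasSum (fun n : ℕ => (1 / (n ! * 1) *
      ∫ g : Matrix.specialUnitaryGroup (Fin 2) ℂ, (su2Quat g).re ^ (k + n)
        ∂haarProbability (Matrix.specialUnitaryGroup (Fin 2) ℂ)) * κ ^ n)
      (∫ g : Matrix.specialUnitaryGroup (Fin 2) ℂ, (su2Quat g).re ^ k * Real.exp (κ * (su2Quat g).re)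
        ∂haarProbability (Matrix.specialUnitaryGroup (Fin 2) ℂ)) := by
    convert h using 1; funext n; ring
  have hlo := partial_le_of_hasSum hκ (fun n => (coeff_mem k n le_rfl).1) h' N
  have hhi := le_partial_add_four_of_hasSum hκ hκ' (fun n => (coeff_mem k n le_rfl).2) h' N
  have e : ∑ n ∈ range N, (1 / (n ! * 1) *
      ∫ g : Matrix.specialUnitaryGroup (Fin 2) ℂ, (su2Quat g).re ^ (k + n)
        ∂haarProbability (Matrix.specialUnitaryGroup (Fin 2) ℂ)) * κ ^ n =
      ∑ n ∈ range N, κ ^ n / n ! *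
        ∫ g : Matrix.specialUnitaryGroup (Fin 2) ℂ, (su2Quat g).re ^ (k + n)
          ∂haarProbability (Matrix.specialUnitaryGroup (Fin 2) ℂ) := sum_congr rfl fun n _ => by ring
  rw [e] at hlo hhi
  exact ⟨hlo, hhi⟩

/-- **Evaluated upper bound of an exponential moment**: for `0 ≤ κ ≤ 4/3`,
`∫ x₀^k e^{κ x₀} dσ ≤ Σ_{n<N} (4/3)^n/n! ∫ x₀^(k+n) dσ + 4 (4/3)^N/N!`. [folklore] -/
theorem sphere_le_eval (k : ℕ) {κ : ℝ} (hκ : 0 ≤ κ) (hκ' : κ ≤ 4 / 3) (N : ℕ) :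
    ∫ g : Matrix.specialUnitaryGroup (Fin 2) ℂ, (su2Quat g).re ^ k * Real.exp (κ * (su2Quat g).re)
        ∂haarProbability (Matrix.specialUnitaryGroup (Fin 2) ℂ)
      ≤ ∑ n ∈ range N, (4 / 3 : ℝ) ^ n / n ! *
          ∫ g : Matrix.specialUnitaryGroup (Fin 2) ℂ, (su2Quat g).re ^ (k + n)
            ∂haarProbability (Matrix.specialUnitaryGroup (Fin 2) ℂ) + 4 * (4 / 3) ^ N / N ! := by
  refine (sphere_bracket k hκ hκ' N).2.trans ?_
  have hm := partial_add_four_mono (N := N) hκ hκ' (fun n => (coeff_mem k n le_rfl).1)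
  have e1 : ∀ t : ℝ, ∑ n ∈ range N, (1 / (n ! * 1) *
      ∫ g : Matrix.specialUnitaryGroup (Fin 2) ℂ, (su2Quat g).re ^ (k + n)
        ∂haarProbability (Matrix.specialUnitaryGroup (Fin 2) ℂ)) * t ^ n =
      ∑ n ∈ range N, t ^ n / n ! *
        ∫ g : Matrix.specialUnitaryGroup (Fin 2) ℂ, (su2Quat g).re ^ (k + n)
          ∂haarProbability (Matrix.specialUnitaryGroup (Fin 2) ℂ) := fun t => sum_congr rfl fun n _ => by ring
  rw [e1, e1] at hm
  exact hm

/-- **The even Haar moments `x₀⁴, x₀⁶, x₀⁸, x₀¹⁰`** in closed form: `1/8, 5/64, 7/128, 21/512` (the recursion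
`integral_re_pow_add_two` from `∫ x₀² dσ = 1/4`; with `∫ x₀⁰ = 1` and the vanishing odd moments this is the
table every bracket of the certificate is evaluated with). [folklore] -/
theorem even_moments :
    (∫ g : Matrix.specialUnitaryGroup (Fin 2) ℂ, (su2Quat g).re ^ 4
        ∂haarProbability (Matrix.specialUnitaryGroup (Fin 2) ℂ) = 1 / 8) ∧
    (∫ g : Matrix.specialUnitaryGroup (Fin 2) ℂ, (su2Quat g).re ^ 6
        ∂haarProbability (Matrix.specialUnitaryGroup (Fin 2) ℂ) = 5 / 64) ∧
    (∫ g : Matrix.specialUnitaryGroup (Fin 2) ℂ, (su2Quat g).re ^ 8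
        ∂haarProbability (Matrix.specialUnitaryGroup (Fin 2) ℂ) = 7 / 128) ∧
    (∫ g : Matrix.specialUnitaryGroup (Fin 2) ℂ, (su2Quat g).re ^ 10
        ∂haarProbability (Matrix.specialUnitaryGroup (Fin 2) ℂ) = 21 / 512) := by
  have h2 : ∫ g : Matrix.specialUnitaryGroup (Fin 2) ℂ, (su2Quat g).re ^ 2
      ∂haarProbability (Matrix.specialUnitaryGroup (Fin 2) ℂ) = 1 / 4 := integral_re_sq
  have h4 := integral_re_pow_add_two 2
  have h6 := integral_re_pow_add_two 4
  have h8 := integral_re_pow_add_two 6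
  have h10 := integral_re_pow_add_two 8
  norm_num at h4 h6 h8 h10
  rw [h2] at h4
  rw [h4] at h6
  rw [h6] at h8
  rw [h8] at h10
  refine ⟨?_, ?_, ?_, ?_⟩ <;> [rw [h4]; rw [h6]; rw [h8]; rw [h10]] <;> norm_num

/-- **The odd Haar moments vanish**: `∫ x₀^1 = ∫ x₀^3 = … = ∫ x₀^11 dσ = 0`, as numerals. [folklore] -/
theorem odd_moments :
    (∫ g : Matrix.specialUnitaryGroup (Fin 2) ℂ, (su2Quat g).re ^ 1
        ∂haarProbability (Matrix.specialUnitaryGroup (Fin 2) ℂ) = 0) ∧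
    (∫ g : Matrix.specialUnitaryGroup (Fin 2) ℂ, (su2Quat g).re ^ 3
        ∂haarProbability (Matrix.specialUnitaryGroup (Fin 2) ℂ) = 0) ∧
    (∫ g : Matrix.specialUnitaryGroup (Fin 2) ℂ, (su2Quat g).re ^ 5
        ∂haarProbability (Matrix.specialUnitaryGroup (Fin 2) ℂ) = 0) ∧
    (∫ g : Matrix.specialUnitaryGroup (Fin 2) ℂ, (su2Quat g).re ^ 7
        ∂haarProbability (Matrix.specialUnitaryGroup (Fin 2) ℂ) = 0) ∧
    (∫ g : Matrix.specialUnitaryGroup (Fin 2) ℂ, (su2Quat g).re ^ 9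
        ∂haarProbability (Matrix.specialUnitaryGroup (Fin 2) ℂ) = 0) ∧
    (∫ g : Matrix.specialUnitaryGroup (Fin 2) ℂ, (su2Quat g).re ^ 11
        ∂haarProbability (Matrix.specialUnitaryGroup (Fin 2) ℂ) = 0) :=
  ⟨by simpa using integral_re_pow_odd 0, by simpa using integral_re_pow_odd 1, by simpa using integral_re_pow_odd 2,
    by simpa using integral_re_pow_odd 3, by simpa using integral_re_pow_odd 4, by simpa using integral_re_pow_odd 5⟩

end Summit.QuantumFields.BalabanUV.InfraRed.StrongCouplingBallSeries

end
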